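import Literature.Geometry.Riemannian.HamiltonCurvatureODE
import Literature.Geometry.Riemannian.ChangGurskyYangProofs
import Literature.Geometry.Riemannian.CkNecks
import Summits.SmoothPoincare4.SmoothPoincare4.Theses.EntropyRung
import HarnessLib

/-!
# Sketch — first lemmas of the three crux ideas for `EntropyRung.ChangGurskyYang`
(crux item stmt-SmoothPoincare4-10834; planner crux-ideate round 1, ideator 2; calibration § added by
ideator-2 gen 2, 2026-08-16)

Only signatures are claimed to elaborate; proofs are `sorry` by design (crux-ideate stage).
-/

noncomputable section

open scoped Manifold ContDiff ENNReal Matrix BigOperators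
open Set

namespace Summit.SmoothPoincare4.SmoothPoincare4.Cruxes.ChangGurskyYang.Sketch

set_option linter.dupNamespace false

open Literature.Geometry.Riemannian
open Literature.Geometry.Riemannian.HamiltonODE
open Literature.Geometry.Lorentzian (PseudoRiemannianMetric)

/-! ## Card 1 & 3: Margerin's weak-pinching cone in Hamilton's block space -/

/-- Frobenius square norm of a `3 × 3` block. -/
def frob (X : Matrix (Fin 3) (Fin 3) ℝ) : ℝ := ∑ i, ∑ j, X i j ^ 2

/-- Frobenius pairing of `3 × 3` blocks. -/
def frobInner (X Y : Matrix (Fin 3) (Fin 3) ℝ) : ℝ := ∑ i, ∑ j, X i j * Y i j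

/-- Traceless Frobenius mass `‖Å‖² + 2‖B‖² + ‖C̊‖²` of a block triple (`= Σ W² + 2 Σ E²` in the
tree's normalisation `tr A = tr C = R/2`, `Σ W_{ijkl}² = ‖Å‖² + ‖C̊‖²`, `Σ E_{ab}² = ‖B‖²`). -/
def tracelessMass (p : Blocks) : ℝ :=
  frob (p.1 - (p.1.trace / 3) • (1 : Matrix (Fin 3) (Fin 3) ℝ)) + 2 * frob p.2.1 +
    frob (p.2.2 - (p.2.2.trace / 3) • (1 : Matrix (Fin 3) (Fin 3) ℝ))

/-- **Margerin's round cone** `WP ≤ k/4`: `‖Å‖² + 2‖B‖² + ‖C̊‖² ≤ k (tr A)²` on the phase space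
`A, C` symmetric, `tr A = tr C ≥ 0`. `k = 2/3` is weak pinching `≤ 1/6` (`S³ × ℝ`, `ℂP²` on the
boundary); `k = 0` is the constant-curvature ray. -/
def margerinCone (k : ℝ) : Set Blocks :=
  {p | p.1.IsSymm ∧ p.2.2.IsSymm ∧ p.1.trace = p.2.2.trace ∧ 0 ≤ p.1.trace ∧
    tracelessMass p ≤ k * p.1.trace ^ 2}

/-- **Margerin's fundamental polynomial at `β = 2`** in block form:
`P₂(p) = (tr A)·⟨M, Q(M)⟩_F − (d/dτ tr A)·‖M‖²_F`, with `Q = HamiltonODE.field`,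
`‖M‖²_F = ‖A‖² + 2‖B‖² + ‖C‖²`, `d/dτ tr A = (tr A)² + ‖B‖²`; its sign is the sign of
`d/dτ (‖M‖²_F/(tr A)²)`, i.e. of `d/dτ WP`, along the ODE. -/
def margerinP2 (p : Blocks) : ℝ :=
  p.1.trace * (frobInner p.1 (field p).1 + 2 * frobInner p.2.1 (field p).2.1 +
      frobInner p.2.2 (field p).2.2) -
    (p.1.trace ^ 2 + frob p.2.1) * (frob p.1 + 2 * frob p.2.1 + frob p.2.2)

/-- Card 1/3, FIRST LEMMA (Margerin 1998, Prop. 4 at `β = 2` / Lemma 9 hypothesis, ODE form):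
the fundamental polynomial is non-positive on the closed `1/6`-cone. One homogeneous QUARTIC
polynomial inequality in the 21 block entries (Margerin's rational `P₂` is cubic; `margerinP2` is
`P₂` cleared of the denominator `scal`), 13 variables after the `O(3) × O(3)` reduction. -/
theorem margerinP2_nonpos : ∀ p ∈ margerinCone (2 / 3), margerinP2 p ≤ 0 := by
  sorry

/-- Card 3, the qualitative consequence used by neck exclusion: every round cone `WP ≤ k/4`,
`0 ≤ k ≤ 2/3`, is forward invariant under Hamilton's ODE (hence, by the named fact
`hamilton_maximumPrinciple_curvatureODE`, along the Ricci flow). -/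
theorem margerinCone_isInvariant :
    ∀ k : ℝ, 0 ≤ k → k ≤ 2 / 3 → IsInvariant field (fun _ ↦ margerinCone k) := by
  sorry

/-- Card 1, the quantitative form (Margerin 1998, Prop. 4, `β ∈ [β₀, 2)`; = a Böhm–Wilking pinching
family / Hamilton pinching set for the round cones): strictly inside the `1/6`-cone the power-law
sets `‖M̊‖² ≤ K (tr A)^{2−σ}` are forward invariant. -/
theorem margerin_pinchingSet :
    ∀ k₀ : ℝ, 0 ≤ k₀ → k₀ < 2 / 3 → ∃ σ : ℝ, 0 < σ ∧ ∀ K : ℝ, 0 < K →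
      IsInvariant field
        (fun _ ↦ margerinCone k₀ ∩ {p | tracelessMass p ≤ K * p.1.trace ^ ((2 : ℝ) - σ)}) := by
  sorry

/-! ## Card 3: neck exclusion -/

/-- Card 3, FIRST GEOMETRIC LEMMA: a `C^{[1/ε]}` `ε`-neck of a Riemannian 4-manifold contains a
point whose weak pinching is within `δ` of the cylinder value `1/6` (curvature is continuous in
the 2-jet of the metric; `WP(S³ × ℝ) = 1/6`). -/
theorem weakPinching_ge_on_neck :
    ∀ δ : ℝ, 0 < δ → ∃ ε₀ : ℝ, 0 < ε₀ ∧
      ∀ (M : Type) [TopologicalSpace M] [T2Space M] [SecondCountableTopology M]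
        [ChartedSpace (EuclideanSpace ℝ (Fin 4)) M] [IsManifold (𝓡 4) ∞ M]
        (g : PseudoRiemannianMetric (𝓡 4) ∞ (EuclideanSpace ℝ (Fin 4)) (TangentSpace (𝓡 4) : M → Type _))
        [g.HasLeviCivita], g.IsRiemannian →
        ∀ (N : Set M) (ε r : ℝ), ε ≤ ε₀ → IsCkEpsNeck 3 g N ε r →
          ∃ y ∈ N, 1 / 6 - δ ≤ g.weakPinching y := by
  sorry

/-! ## Card 2: the Gursky–Viaclovsky continuity path for the Weyl-weighted `σ₂` equation -/

/-- Card 2, FIRST LEMMA = the line's form of Chang–Gursky–Yang Thm. 1.4 (`α = 1`) à la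
Gursky–Viaclovsky 2003, Thm. 1: background `scal > 0` (the crux's own hypothesis) replaces
`Y > 0`, and positivity of the scalar curvature of the solution is part of the output (solutions
stay in `Γ₂⁺` along the path), so that the tree's reduction
`changGurskyYang_sphere_four_of_margerin_of_pointwisePinching` consumes it with CGB only. -/
theorem thm14_gurskyViaclovsky :
    ∀ (M : Type) [TopologicalSpace M] [T2Space M] [SecondCountableTopology M]
      [ChartedSpace (EuclideanSpace ℝ (Fin 4)) M] [IsManifold (𝓡 4) ∞ M] [CompactSpace M]
      [ConnectedSpace M] [MeasurableSpace M] [BorelSpace M]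
      (g₀ : PseudoRiemannianMetric (𝓡 4) ∞ (EuclideanSpace ℝ (Fin 4)) (TangentSpace (𝓡 4) : M → Type _))
      [g₀.HasLeviCivita] (hg₀ : g₀.IsRiemannian),
      (∀ x, 0 < g₀.scalarCurvature x) →
      1 / 4 * g₀.weylEnergy.toReal < g₀.sigma2WeylSchoutenIntegral →
      ∃ (g : PseudoRiemannianMetric (𝓡 4) ∞ (EuclideanSpace ℝ (Fin 4)) (TangentSpace (𝓡 4) : M → Type _))
        (_ : g.HasLeviCivita) (hg : g.IsRiemannian),
        IsConformalTo (g.toContMDiffRiemannianMetric hg) (g₀.toContMDiffRiemannianMetric hg₀) ∧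
        (∀ x, 0 < g.scalarCurvature x) ∧ ∀ x, 1 / 4 * g.weylNormSq x < g.sigma2WeylSchouten x := by
  sorry

/-- Card 2, the algebraic engine of the `C⁰` sup-estimate along the path (Gursky–Viaclovsky 2003,
§3, `(4/√6) f e^{2u} ≤ σ₁`): Maclaurin's inequality `σ₂(λ) ≤ (3/8) σ₁(λ)²` for four reals. -/
theorem maclaurin_sigma2_four (l : Fin 4 → ℝ) :
    (l 0 * l 1 + l 0 * l 2 + l 0 * l 3 + l 1 * l 2 + l 1 * l 3 + l 2 * l 3) ≤
      3 / 8 * (l 0 + l 1 + l 2 + l 3) ^ 2 := by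
  nlinarith [sq_nonneg (l 0 - l 1), sq_nonneg (l 0 - l 2), sq_nonneg (l 0 - l 3),
    sq_nonneg (l 1 - l 2), sq_nonneg (l 1 - l 3), sq_nonneg (l 2 - l 3)]

/-! ## Calibration (ideator 2, gen 2): the two rigid rays are the contact points of the `1/6`-cone

Kernel-checked versions of the hand computations behind the cards' cheapest falsifier (and of the
binding directions found numerically by kit job j008125), in the `+2B^#` convention of
`HamiltonODE.field` and the normalisation `t = tr A = tr C = 1`:
* neck family `(⅓·1, b·1, ⅓·1)` (round `S³ × ℝ` at `b = ⅓`): `‖M̊‖² = 6b²`, `P₂ = −2b²(1−3b)²`;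
* `ℂP²` family `(diag(⅓+2w, ⅓−w, ⅓−w), 0, ⅓·1)` (`(ℂP², g_FS)` at `w = ⅓`): `‖M̊‖² = 6w²`,
  `P₂ = 6w²(3w−1)`.
So both rays lie on `∂C(2/3)` (`6·(⅓)² = 2/3`) with `P₂ = 0`; along the neck family `P₂ ≤ 0` on
both sides (double zero), along the `ℂP²` family `P₂` changes sign exactly at the boundary (simple
zero) — the zero structure an SOS/Positivstellensatz certificate for `margerinP2_nonpos` must have. -/

/-- The neck family through the round cylinder `S³ × ℝ` (`b = ⅓`), `t = 1`. -/
def neckBlocks (b : ℝ) : Blocks :=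
  ((1 / 3 : ℝ) • (1 : Matrix (Fin 3) (Fin 3) ℝ), b • (1 : Matrix (Fin 3) (Fin 3) ℝ),
    (1 / 3 : ℝ) • (1 : Matrix (Fin 3) (Fin 3) ℝ))

/-- The `ℂP²` family through `(ℂP², g_FS)` (`w = ⅓`), `t = 1`. -/
def cp2Blocks (w : ℝ) : Blocks :=
  (Matrix.diagonal ![1 / 3 + 2 * w, 1 / 3 - w, 1 / 3 - w], 0,
    (1 / 3 : ℝ) • (1 : Matrix (Fin 3) (Fin 3) ℝ))

/-- `M^#` of a diagonal `3 × 3` matrix. -/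
theorem sharp_diagonal_fin_three (v : Fin 3 → ℝ) :
    (Matrix.diagonal v).sharp = Matrix.diagonal ![v 1 * v 2, v 0 * v 2, v 0 * v 1] := by
  have h0 : (Finset.univ.erase (0 : Fin 3)) = {1, 2} := by decide
  have h1 : (Finset.univ.erase (1 : Fin 3)) = {0, 2} := by decide
  have h2 : (Finset.univ.erase (2 : Fin 3)) = {0, 1} := by decide
  rw [Matrix.sharp, Matrix.adjugate_diagonal, Matrix.diagonal_transpose]
  congr 1
  funext i
  fin_cases i
  · simp [h0]
  · simp [h1]
  · simp [h2]

/-- `M^#` of the zero `3 × 3` matrix. -/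
theorem sharp_zero_fin_three : (0 : Matrix (Fin 3) (Fin 3) ℝ).sharp = 0 := by
  ext i j
  fin_cases i <;> fin_cases j <;> simp [Matrix.sharp]

/-- `M^#` of a scalar `3 × 3` matrix. -/
theorem sharp_smul_one_fin_three (c : ℝ) :
    (c • (1 : Matrix (Fin 3) (Fin 3) ℝ)).sharp = (c ^ 2) • (1 : Matrix (Fin 3) (Fin 3) ℝ) := by
  simp [Matrix.sharp, Matrix.adjugate_smul, Matrix.adjugate_one]

theorem tracelessMass_neckBlocks (b : ℝ) : tracelessMass (neckBlocks b) = 6 * b ^ 2 := by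
  simp [tracelessMass, neckBlocks, frob, Matrix.trace, Matrix.smul_apply, Matrix.one_apply,
    Matrix.sub_apply]
  ring

theorem tracelessMass_cp2Blocks (w : ℝ) : tracelessMass (cp2Blocks w) = 6 * w ^ 2 := by
  simp [tracelessMass, cp2Blocks, frob, Matrix.trace, Fin.sum_univ_three, Matrix.smul_apply,
    Matrix.one_apply, Matrix.sub_apply, Matrix.diagonal_apply]
  ring

/-- **Neck calibration**: `P₂ = −2b²(1−3b)²` along the neck family; `= 0` exactly at `S³ × ℝ`. -/
theorem margerinP2_neckBlocks (b : ℝ) :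
    margerinP2 (neckBlocks b) = -(2 * b ^ 2 * (1 - 3 * b) ^ 2) := by
  simp [margerinP2, neckBlocks, frob, frobInner, field, Matrix.sharp, Matrix.adjugate_fin_three,
    Matrix.trace, Fin.sum_univ_three, Matrix.smul_apply, Matrix.one_apply]
  ring

/-- **`ℂP²` calibration**: `P₂ = 6w²(3w−1)` along the `ℂP²` family; `= 0` exactly at `g_FS`. -/
theorem margerinP2_cp2Blocks (w : ℝ) :
    margerinP2 (cp2Blocks w) = 6 * w ^ 2 * (3 * w - 1) := by
  simp only [margerinP2, cp2Blocks, field, sharp_diagonal_fin_three, sharp_zero_fin_three,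
    sharp_smul_one_fin_three]
  simp [frob, frobInner, Matrix.trace, Fin.sum_univ_three, Matrix.smul_apply, Matrix.one_apply,
    Matrix.add_apply, Matrix.diagonal_apply]
  ring

/-- Both rigid rays sit on the boundary of the `1/6`-cone with `P₂ = 0`. -/
theorem rigidRays_contact :
    tracelessMass (neckBlocks (1 / 3)) = 2 / 3 * (neckBlocks (1 / 3)).1.trace ^ 2 ∧
      margerinP2 (neckBlocks (1 / 3)) = 0 ∧
      tracelessMass (cp2Blocks (1 / 3)) = 2 / 3 * (cp2Blocks (1 / 3)).1.trace ^ 2 ∧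
      margerinP2 (cp2Blocks (1 / 3)) = 0 := by
  refine ⟨?_, ?_, ?_, ?_⟩
  · rw [tracelessMass_neckBlocks]
    simp [neckBlocks, Matrix.trace, Matrix.smul_apply]
    norm_num
  · rw [margerinP2_neckBlocks]; norm_num
  · rw [tracelessMass_cp2Blocks]
    simp [cp2Blocks, Matrix.trace, Fin.sum_univ_three]
    norm_num
  · rw [margerinP2_cp2Blocks]; norm_num

/-! ## Sanity: the crux decl is the Literature fact verbatim -/

example : Summit.SmoothPoincare4.SmoothPoincare4.Theses.EntropyRung.ChangGurskyYang ↔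
    changGurskyYang_sphere_four := Iff.rfl

end Summit.SmoothPoincare4.SmoothPoincare4.Cruxes.ChangGurskyYang.Sketch

end
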